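import Summits.BirchSwinnertonDyer.BirchSwinnertonDyer.Theorems.ManinLocalTwoThreeShimuraQuotientRational
import Literature.NumberTheory.EllipticCurves.Gamma1ParametrizationCuspGaloisAction
import Literature.NumberTheory.EllipticCurves.ManinConstantGamma1Gamma0LedgerProofs
import HarnessLib
import HarnessLib.Audit.Tags

/-!
# THEOREM K (Kummer–diamond reciprocity) as a Lean theorem modulo Stevens 1982 Thm. 1.3.1(b)
# (cell `bsd-f2-manin`, seat `-es` g39, MEMO-es §60; LEAD line `kummer_diamond`, stub D5)

MEMO-es §59.3 stated THEOREM K — «the `2`-descent cocycle of the Kummer point over the Atkin–Lehner point `R_Q` is the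
diamond image of the inverse mod-`Q` cyclotomic character, `δ(R_Q) = ϖ_Q ∘ χ_Q⁻¹`» — and the LEAD line card
`Cruxes/ManinOddAtFour/Lines/kummer_diamond.md` lists it as «D5, THE hard stub, typable now as a LAW».  This file makes it a
THEOREM of the tree's analytic dictionary modulo the one printed fact T-es-75 (Stevens 1982 Thm. 1.3.1(b), landed p759460):

* §1 `exists_gamma0_cusp_transport` — pure integer arithmetic: for `N = Q·y`, `gcd(Q,y) = 1`, `(d′, N) = 1` an explicit
  `γ₀ ∈ Γ₀(N)` with `d_{γ₀} ≡ d′ (mod Q)`, `d_{γ₀} ≡ 1 (mod y)` and `γ₀·(1/y) = 1/(d′y)` EXACTLY (numerator `1/y`,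
  denominator `d′`), so that Manin's relation applies with no cusp-equivalence bookkeeping;
* §2 `kummerDiamondReciprocity` — THEOREM K♮ on Stevens' curve for ALL `Q ∥ N`:
  `σ(φ₁(1/y)) = φ₁(1/y) + π₁(c₁{∞,γ∞}_f)` for every `γ ∈ Γ₀(N)` of diamond class `(d′ mod Q, 1 mod y)`;
* §3 `map_uniformize_transfer_of_lattice_eq` (Galois transfer along equal Néron lattices, `z ↦ ±z` and the rational
  coordinate change) and `indexFour_kummerDiamondReciprocity` — THEOREM K in the index-`4` configuration on the
  `X₀(N)`-optimal curve `W₀` (the D5 stub; modulo T-es-75 ∧ CES): `σ(S) = S + π₀(c₀{∞,γ∞}_f/2)` for the Kummer point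
  `S = π₀(c₀{∞,1/y}_f/2)` over `R_Q`.

What this buys for E-es-185 (`IndexFourForcesFreyTwistShape`): its STEP 2 input is now kernel-checked modulo {T-es-75, CES};
the remaining stubs are D3 (rationality/torsion of `R_Q`), D4 (2-descent dictionary), D6 (group theory, p2 p759441 lemmas),
D7 (case table, p1 p759380), D8 (p758887), D9/186♭ (p758063).  HONEST FRAMING: conditional on the named facts T-es-75 and CES
(statement-only, printed); E-es-185, C2 `ManinOddAtFour`, Manin's conjecture and BSD are NOT proved by this file.  No sorry.

TYPER NOTE (typer g21, T-es-77).  SOURCE = HOME/es/g39/KummerDiamondReciprocity-es-g39.lean sha16 7056eb23ac3e796d (339 l.; es: farm rc 0·0·0·0,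
std axioms; MEMO-es §60; LEAD line `kummer_diamond`, stub D5) VERBATIM with exactly two deltas: (i) DEDUP REPAIR — the sketch restated, as
`gamma0_uniformize_eq_zero_iff (D : ModularParametrizationData W₀ N) (z) : D.uniformize z = 0 ↔ z ∈ D.L.lattice`, the Literature lemma
`ModularParametrizationData.uniformize_eq_zero_iff` (`Literature/NumberTheory/EllipticCurves/ModularCurve.lean`, same statement and proof); that
restatement is dropped and its one use (`hker₀` in `map_uniformize_transfer_of_lattice_eq`) now reads `D₀.uniformize_eq_zero_iff` (the gate dedups
identical statements tree-wide; CONVENTIONS: cite, do not restate); (ii) the sketch's `set_option linter.dupNamespace false` is dropped — nothing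
in the file triggers that linter (farm: 0 warnings without it) and the gate books a disabled linter as lint debt; (iii) this note.  CONE SIDE by construction (imports
`Theorems.ManinLocalTwoThreeShimuraQuotientRational`, inside the `Theses.ManinLocalTwoThree` import cone) + the Literature facts file
`Gamma1ParametrizationCuspGaloisAction` (T-es-75, p759460) + `ManinConstantGamma1Gamma0LedgerProofs`; theorem-only (kind proof), no `def … : Prop`,
nothing conjectural introduced; no tree declaration bore these names or statements at landing (rg 04:0xZ: `exists_gamma0_cusp_transport`,
`uniformize_cuspSymbol_eq_of_apply_eq`, `intCast_zmod_eq_of_eq_mod_coprime`, `kummerDiamondReciprocity`, `map_uniformize_transfer_of_lattice_eq`,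
`indexFour_kummerDiamondReciprocity`).  HONEST FRAMING as es states it: THEOREM K♮ / THEOREM K (index 4) are kernel theorems MODULO the named
printed facts T-es-75 (`optimalGamma1Parametrization_cuspInv_galoisAction`, hypothesis `hSt`) and CES (`exists_optimal_gamma1ParametrizationData`,
`hCES`); E-es-185, C2 `ManinOddAtFour`, Manin c = 1 and BSD are NOT proved by this file; C2/C3 OPEN.  bears_on: stmt-BirchSwinnertonDyer-22967.
-/

set_option autoImplicit false

noncomputable section

open scoped Classical MatrixGroups ModularForm

open CongruenceSubgroup Complex WeierstrassCurve Literature.NumberTheory.EllipticCurves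
  Literature.NumberTheory.EllipticCurves.ModularForms
open Summit.BirchSwinnertonDyer.BirchSwinnertonDyer.Theorems.ManinLocalTwoThree

namespace Summit.BirchSwinnertonDyer.Rank1Residual.ManinAdditive.KummerDiamond

/-! ### §0. The printed input: T-es-75 = the tree named fact `optimalGamma1Parametrization_cuspInv_galoisAction`
(`Literature/NumberTheory/EllipticCurves/Gamma1ParametrizationCuspGaloisAction.lean`, p759460; Stevens 1982 Thm. 1.3.1(b) at
the cusps `1/y` of `X₁(N)`: `σ(φ₁(1/y)) = φ₁(1/(d′y))` for `σ|ζ_N = τ_d`, `dd′ ≡ 1 (N)`).  Below it is the hypothesis `hSt`;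
CES = `exists_optimal_gamma1ParametrizationData` is `hCES`.  No other fact is used. -/

/-! ### §1. Cusp transport inside `Γ₀(N)`: `[1; y] ↦ [1; d′y]` by an explicit `γ ∈ Γ₀(N)` with
`d_γ ≡ d′ (mod Q)`, `d_γ ≡ 1 (mod y)` (`N = Q·y`, `(Q, y) = 1`, `(d′, N) = 1`). Pure integer arithmetic. -/

/-- **Cusp transport lemma.**  For `N = Q·y` with `gcd(Q, y) = 1` and `d′` coprime to `N` there is
`γ = (1 − b y, b; N k, δ) ∈ Γ₀(N)` with `δ ≡ d′ (mod Q)`, `δ ≡ 1 (mod y)`, and `γ·(1/y) = 1/(d′y)` on the nose: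
`(γ₀₀/y + γ₀₁) = 1/y`, `(γ₁₀/y + γ₁₁) = d′`.  (Take `b ≡ (d′−1)(d′y)⁻¹ (mod Q)`, `δ = 1 + b d′ y`.) [folklore] -/
theorem exists_gamma0_cusp_transport {N : ℕ} [NeZero N] (Q y : ℕ) (hQy : Q * y = N) (hcop : Nat.Coprime Q y)
    (d' : ℤ) (hd' : IsCoprime d' (N : ℤ)) :
    ∃ γ : Gamma0 N,
      ((((γ : SL(2, ℤ)) 1 1 : ℤ) : ZMod Q) = (d' : ZMod Q)) ∧
      ((((γ : SL(2, ℤ)) 1 1 : ℤ) : ZMod y) = 1) ∧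
      (((γ : SL(2, ℤ)) 0 0 : ℚ) * (1 / (y : ℚ)) + ((γ : SL(2, ℤ)) 0 1 : ℚ) = 1 / (y : ℚ)) ∧
      (((γ : SL(2, ℤ)) 1 0 : ℚ) * (1 / (y : ℚ)) + ((γ : SL(2, ℤ)) 1 1 : ℚ) = d') := by
  have hN0 : N ≠ 0 := NeZero.ne N
  have hy0 : y ≠ 0 := by rintro rfl; exact hN0 (by rw [← hQy, mul_zero])
  have hyQ : (y : ℚ) ≠ 0 := by exact_mod_cast hy0
  have hy1 : (y : ℚ) * (1 / (y : ℚ)) = 1 := mul_one_div_cancel hyQ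
  -- `d′ y` is invertible modulo `Q`
  have hcopQ : IsCoprime (d' * (y : ℤ)) (Q : ℤ) := by
    refine IsCoprime.mul_left ?_ ?_
    · have h : IsCoprime d' ((Q : ℤ) * (y : ℤ)) := by
        have e : ((Q : ℤ) * (y : ℤ)) = (N : ℤ) := by exact_mod_cast hQy
        rwa [e]
      exact h.of_mul_right_left
    · exact Nat.isCoprime_iff_coprime.2 hcop.symm
  obtain ⟨u, v, huv⟩ := hcopQ
  -- the matrix `(1 − B y, B; N (d′−1) v, 1 + B d′ y)`, `B = (d′ − 1) u`
  have hNZ : (N : ℤ) = (Q : ℤ) * (y : ℤ) := by exact_mod_cast hQy.symm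
  refine ⟨⟨⟨!![1 - (d' - 1) * u * y, (d' - 1) * u; (N : ℤ) * ((d' - 1) * v), 1 + (d' - 1) * u * d' * y], ?_⟩,
    ?_⟩, ?_, ?_, ?_, ?_⟩
  · rw [Matrix.det_fin_two_of, hNZ]
    linear_combination (-((d' - 1) ^ 2 * u * (y : ℤ))) * huv
  · rw [Gamma0_mem]
    show ((((N : ℤ) * ((d' - 1) * v) : ℤ) : ZMod N)) = 0
    simp
  · show (((1 + (d' - 1) * u * d' * y : ℤ)) : ZMod Q) = (d' : ZMod Q)
    rw [ZMod.intCast_eq_intCast_iff_dvd_sub]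
    exact ⟨(d' - 1) * v, by linear_combination (-(d' - 1)) * huv⟩
  · show (((1 + (d' - 1) * u * d' * y : ℤ)) : ZMod y) = 1
    have e : (1 + (d' - 1) * u * d' * y : ℤ) = 1 + (y : ℤ) * ((d' - 1) * u * d') := by ring
    rw [e]
    push_cast
    simp
  · show ((1 - (d' - 1) * u * y : ℤ) : ℚ) * (1 / (y : ℚ)) + (((d' - 1) * u : ℤ) : ℚ) = 1 / (y : ℚ)
    calc ((1 - (d' - 1) * u * y : ℤ) : ℚ) * (1 / (y : ℚ)) + (((d' - 1) * u : ℤ) : ℚ)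
        = 1 / (y : ℚ) - ((d' : ℚ) - 1) * u * ((y : ℚ) * (1 / (y : ℚ))) + ((d' : ℚ) - 1) * u := by
          push_cast; ring
      _ = 1 / (y : ℚ) := by rw [hy1]; ring
  · show (((N : ℤ) * ((d' - 1) * v) : ℤ) : ℚ) * (1 / (y : ℚ)) + ((1 + (d' - 1) * u * d' * y : ℤ) : ℚ) = d'
    have huvQ : (u : ℚ) * (d' * y) + v * Q = 1 := by exact_mod_cast huv
    calc (((N : ℤ) * ((d' - 1) * v) : ℤ) : ℚ) * (1 / (y : ℚ)) + ((1 + (d' - 1) * u * d' * y : ℤ) : ℚ)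
        = (Q : ℚ) * (((d' : ℚ) - 1) * v) * ((y : ℚ) * (1 / (y : ℚ))) + (1 + ((d' : ℚ) - 1) * u * d' * y) := by
          rw [hNZ]; push_cast; ring
      _ = d' := by rw [hy1]; linear_combination ((d' : ℚ) - 1) * huvQ

/-! ### §2. THEOREM K on Stevens' curve (all `Q ∥ N`): the Kummer–diamond reciprocity -/

section StevensCurve

section Helpers

variable {W : WeierstrassCurve ℚ} {N : ℕ} [NeZero N]

/-- Periods with the same lower-right entry modulo `N` have the same image on Stevens' curve. [folklore] -/
theorem uniformize_cuspSymbol_eq_of_apply_eq (D : Gamma1ParametrizationData W N) (γ₀ γ : Gamma0 N)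
    (h : (((γ₀ : SL(2, ℤ)) 1 1 : ℤ) : ZMod N) = (((γ : SL(2, ℤ)) 1 1 : ℤ) : ZMod N)) :
    D.uniformize ((D.c : ℂ) * cuspSymbol D.f γ) = D.uniformize ((D.c : ℂ) * cuspSymbol D.f γ₀) := by
  rw [← sub_eq_zero, ← map_sub, ← mul_sub, gamma1_uniformize_eq_zero_iff]
  exact D.smul_periodLatticeGamma1_le _ (cuspSymbol_sub_mem_periodLatticeGamma1_of_apply_eq D.f γ₀ γ h)

omit [NeZero N] in
/-- CRT on lower-right entries: congruent modulo `Q` and modulo `y`, `gcd(Q, y) = 1`, means congruent modulo `N = Qy`.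
[folklore] -/
theorem intCast_zmod_eq_of_eq_mod_coprime {Q y : ℕ} (hQy : Q * y = N) (hcop : Nat.Coprime Q y) {s t : ℤ}
    (hQ : ((s : ℤ) : ZMod Q) = (t : ZMod Q)) (hy' : ((s : ℤ) : ZMod y) = (t : ZMod y)) :
    ((s : ℤ) : ZMod N) = (t : ZMod N) := by
  rw [ZMod.intCast_eq_intCast_iff_dvd_sub] at hQ hy' ⊢
  have h : (Q : ℤ) * (y : ℤ) ∣ t - s := IsCoprime.mul_dvd (Nat.isCoprime_iff_coprime.2 hcop) hQ hy'
  have e : ((Q : ℤ) * (y : ℤ)) = (N : ℤ) := by exact_mod_cast hQy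
  rwa [e] at h

end Helpers

/-- **THEOREM K♮ — Kummer–diamond reciprocity on Stevens' curve, all `Q ∥ N` (MEMO-es §59.3/§60; THEOREM modulo
T-es-75).**  For an elliptic `W/ℚ` with an OPTIMAL `X₁(N)`-datum `D`, every `σ ∈ Aut_ℚ(ℂ)` with `σ(ζ_N) = ζ_N^d`,
`dd′ ≡ 1 (mod N)`, every factorisation `N = Q·y` with `gcd(Q, y) = 1`, and every `γ ∈ Γ₀(N)` with `d_γ ≡ d′ (mod Q)`,
`d_γ ≡ 1 (mod y)`:  `σ(φ₁(1/y)) = φ₁(1/y) + π₁(c₁·{∞, γ∞}_f)` — the Galois action on the value at the Atkin–Lehner cusp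
`1/y` IS translation by the image of any `Γ₀(N)`-period of diamond class `(d′ mod Q, 1 mod y)`; in the notation of
§59.3, `δ(R_Q)(σ) = ϖ_Q(χ_Q(σ)⁻¹)`.  Proof: Stevens (b) moves `φ₁(1/y)` to `φ₁(1/(d′y))`; the transport `γ₀ ∈ Γ₀(N)`
of §1 has `γ₀·(1/y) = 1/(d′y)` exactly, so Manin's relation gives `{∞,1/(d′y)} = {∞,γ₀∞} + {∞,1/y}`; and
`{∞,γ∞} − {∞,γ₀∞} ∈ Λ₁(f)` for every `γ` of the same class `d_{γ₀} mod N` (CRT), killed by `c₁Λ₁(f) ⊆ Λ_{E₁}`.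
[cite: Stevens1982, Thm. 1.3.1(b)] [cite: Manin1972, Prop. 1.4 / Thm. 1.6] [cite: Stevens1989, §2] -/
theorem kummerDiamondReciprocity (hSt : optimalGamma1Parametrization_cuspInv_galoisAction) (W : WeierstrassCurve ℚ) [W.IsElliptic]
    {N : ℕ} [NeZero N] (D : Gamma1ParametrizationData W N) (hD : D.IsOptimal) (σ : ℂ ≃ₐ[ℚ] ℂ) (d d' : ℤ)
    (hdd' : ((d * d' : ℤ) : ZMod N) = 1)
    (hσ : σ (Complex.exp (2 * Real.pi * Complex.I / N)) = Complex.exp (2 * Real.pi * Complex.I * d / N))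
    (Q y : ℕ) (hQy : Q * y = N) (hcop : Nat.Coprime Q y) (γ : Gamma0 N)
    (hγQ : (((γ : SL(2, ℤ)) 1 1 : ℤ) : ZMod Q) = (d' : ZMod Q)) (hγy : (((γ : SL(2, ℤ)) 1 1 : ℤ) : ZMod y) = 1) :
    Affine.Point.map (W' := W) (σ : ℂ →ₐ[ℚ] ℂ) (D.uniformize ((D.c : ℂ) * modularSymbol D.f (1 / (y : ℚ)))) =
      D.uniformize ((D.c : ℂ) * modularSymbol D.f (1 / (y : ℚ))) + D.uniformize ((D.c : ℂ) * cuspSymbol D.f γ) := by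
  have hN0 : N ≠ 0 := NeZero.ne N
  have hy0 : y ≠ 0 := by rintro rfl; exact hN0 (by rw [← hQy, mul_zero])
  have hyZ : (y : ℤ) ≠ 0 := by exact_mod_cast hy0
  by_cases hd'0 : d' = 0
  · -- then `N = 1`: everything is a `Γ₁(1)`-period
    subst hd'0
    have hN1 : N = 1 := by
      rw [mul_zero, Int.cast_zero] at hdd'
      have h1 : (1 : ZMod N).val = 0 := by rw [← hdd', ZMod.val_zero]
      rw [ZMod.val_one_eq_one_mod] at h1
      exact Nat.eq_one_of_dvd_one (Nat.dvd_of_mod_eq_zero h1) |>.symm ▸ rfl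
    subst hN1
    have h1 : ((d * 1 : ℤ) : ZMod 1) = 1 := Subsingleton.elim _ _
    have hmain := hSt W D hD σ d 1 h1 hσ (y : ℤ) hyZ
    rw [Int.cast_one, one_mul, Int.cast_natCast] at hmain
    rw [hmain, left_eq_add, gamma1_uniformize_eq_zero_iff]
    exact D.smul_periodLatticeGamma1_le _
      (cuspSymbol_mem_periodLatticeGamma1_of_apply_eq_one D.f γ (Subsingleton.elim _ _))
  · -- `d′` is coprime to `N`
    have hd'cop : IsCoprime d' (N : ℤ) := by
      have h := (ZMod.intCast_eq_intCast_iff_dvd_sub (d * d') 1 N).mp (by rw [hdd', Int.cast_one])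
      obtain ⟨m, hm⟩ := h
      exact ⟨d, m, by linear_combination -hm⟩
    obtain ⟨γ₀, hγ₀Q, hγ₀y, hnum, hden⟩ := exists_gamma0_cusp_transport Q y hQy hcop d' hd'cop
    -- Stevens (b)
    have hmain := hSt W D hD σ d d' hdd' hσ (y : ℤ) hyZ
    rw [Int.cast_natCast] at hmain
    -- Manin relation along `γ₀`
    have hr : ((γ₀ : SL(2, ℤ)) 1 0 : ℚ) * (1 / (y : ℚ)) + ((γ₀ : SL(2, ℤ)) 1 1 : ℚ) ≠ 0 := by
      rw [hden]; exact_mod_cast hd'0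
    have hManin := modularSymbol_gamma0_smul_holds D.f γ₀ (1 / (y : ℚ)) hr
    rw [hnum, hden, show (1 / (y : ℚ)) / (d' : ℚ) = 1 / ((d' : ℚ) * y) by rw [div_div, mul_comm]] at hManin
    rw [hmain, hManin, mul_add, map_add, add_comm, uniformize_cuspSymbol_eq_of_apply_eq D γ₀ γ]
    exact intCast_zmod_eq_of_eq_mod_coprime hQy hcop (hγ₀Q.trans hγQ.symm) (hγ₀y.trans hγy.symm)

end StevensCurve

/-! ### §3. Transfer to the `X₀(N)`-optimal curve in the index-`4` configuration (the D5 stub of the LEAD line) -/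

section IndexFour

section Transfer

variable {W₁ W₀ : WeierstrassCurve ℚ} {N : ℕ} [NeZero N]

/-- **Galois transfer along equal Néron lattices.**  If an `X₁(N)`-datum `D₁` of `W₁` and an `X₀(N)`-datum `D₀` of
`W₀` have the SAME Néron lattice `Λ`, then the two `℘`-uniformisations differ by the `ℚ`-rational change of
coordinates `x₀ = x₁ + (b₂(W₁) − b₂(W₀))/12`, `2y₀ + a₁⁰x₀ + a₃⁰ = ε(2y₁ + a₁¹x₁ + a₃¹)` composed with `z ↦ εz`
(`ε = ±1`), which commutes with every `σ ∈ Aut_ℚ(ℂ)`: so `σ(π₁ z) = π₁ z′ ⟹ σ(π₀(εz)) = π₀(εz′)`. [folklore] -/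
theorem map_uniformize_transfer_of_lattice_eq (D₁ : Gamma1ParametrizationData W₁ N)
    (D₀ : ModularParametrizationData W₀ N) (hΛ : D₀.L.lattice = D₁.L.lattice) {ε : ℂ} (hε : ε = 1 ∨ ε = -1)
    (σ : ℂ ≃ₐ[ℚ] ℂ) {z z' : ℂ}
    (h : Affine.Point.map (W' := W₁) (σ : ℂ →ₐ[ℚ] ℂ) (D₁.uniformize z) = D₁.uniformize z') :
    Affine.Point.map (W' := W₀) (σ : ℂ →ₐ[ℚ] ℂ) (D₀.uniformize (ε * z)) = D₀.uniformize (ε * z') := by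
  have hker₁ := gamma1_uniformize_eq_zero_iff D₁
  have hker₀ := D₀.uniformize_eq_zero_iff
  have hεmem : ∀ w : ℂ, w ∈ D₁.L.lattice ↔ ε * w ∈ D₀.L.lattice := by
    intro w
    rcases hε with rfl | rfl
    · rw [one_mul, hΛ]
    · rw [neg_one_mul, hΛ, neg_mem_iff]
  have hσε : (σ : ℂ →ₐ[ℚ] ℂ) ε = ε := by
    rcases hε with rfl | rfl
    · exact map_one _
    · rw [map_neg, map_one]
  -- `℘`, `℘′` only depend on the lattice; `℘` is even, `℘′` odd
  have hP : ∀ w : ℂ, D₀.L.weierstrassP (ε * w) = D₁.L.weierstrassP w := by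
    intro w
    rw [PeriodPair.weierstrassP_eq_of_lattice_eq hΛ]
    rcases hε with rfl | rfl
    · rw [one_mul]
    · rw [neg_one_mul, PeriodPair.weierstrassP_neg]
  have hP' : ∀ w : ℂ, D₀.L.derivWeierstrassP (ε * w) = ε * D₁.L.derivWeierstrassP w := by
    intro w
    rw [PeriodPair.derivWeierstrassP_eq_of_lattice_eq hΛ]
    rcases hε with rfl | rfl
    · rw [one_mul, one_mul]
    · rw [neg_one_mul, PeriodPair.derivWeierstrassP_neg, neg_one_mul]
  -- the rational coefficients are fixed by `σ`
  have hA₁ : (σ : ℂ →ₐ[ℚ] ℂ) (W₁.baseChange ℂ).a₁ = (W₁.baseChange ℂ).a₁ := by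
    rw [show (W₁.baseChange ℂ).a₁ = (W₁.a₁ : ℂ) by simp [WeierstrassCurve.baseChange, WeierstrassCurve.map_a₁]]
    exact map_ratCast _ _
  have hA₃ : (σ : ℂ →ₐ[ℚ] ℂ) (W₁.baseChange ℂ).a₃ = (W₁.baseChange ℂ).a₃ := by
    rw [show (W₁.baseChange ℂ).a₃ = (W₁.a₃ : ℂ) by simp [WeierstrassCurve.baseChange, WeierstrassCurve.map_a₃]]
    exact map_ratCast _ _
  have hB₁ : (σ : ℂ →ₐ[ℚ] ℂ) (W₁.baseChange ℂ).b₂ = (W₁.baseChange ℂ).b₂ := by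
    rw [show (W₁.baseChange ℂ).b₂ = (W₁.b₂ : ℂ) by simp [WeierstrassCurve.baseChange, WeierstrassCurve.map_b₂]]
    exact map_ratCast _ _
  have hA₁' : (σ : ℂ →ₐ[ℚ] ℂ) (W₀.baseChange ℂ).a₁ = (W₀.baseChange ℂ).a₁ := by
    rw [show (W₀.baseChange ℂ).a₁ = (W₀.a₁ : ℂ) by simp [WeierstrassCurve.baseChange, WeierstrassCurve.map_a₁]]
    exact map_ratCast _ _
  have hA₃' : (σ : ℂ →ₐ[ℚ] ℂ) (W₀.baseChange ℂ).a₃ = (W₀.baseChange ℂ).a₃ := by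
    rw [show (W₀.baseChange ℂ).a₃ = (W₀.a₃ : ℂ) by simp [WeierstrassCurve.baseChange, WeierstrassCurve.map_a₃]]
    exact map_ratCast _ _
  have hB₀ : (σ : ℂ →ₐ[ℚ] ℂ) (W₀.baseChange ℂ).b₂ = (W₀.baseChange ℂ).b₂ := by
    rw [show (W₀.baseChange ℂ).b₂ = (W₀.b₂ : ℂ) by simp [WeierstrassCurve.baseChange, WeierstrassCurve.map_b₂]]
    exact map_ratCast _ _
  have h2 : (σ : ℂ →ₐ[ℚ] ℂ) 2 = 2 := map_ofNat _ 2
  have h12 : (σ : ℂ →ₐ[ℚ] ℂ) 12 = 12 := map_ofNat _ 12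
  by_cases hz : z ∈ D₁.L.lattice
  · -- both source points are `0`, hence so are the targets
    have h0 : D₁.uniformize z = 0 := (hker₁ z).mpr hz
    rw [h0, map_zero] at h
    have hz' : z' ∈ D₁.L.lattice := (hker₁ z').mp h.symm
    rw [(hker₀ _).mpr ((hεmem z).mp hz), (hker₀ _).mpr ((hεmem z').mp hz'), map_zero]
  · obtain ⟨n₁, hspec⟩ := D₁.uniformize_spec z hz
    have hz' : z' ∉ D₁.L.lattice := by
      intro hz'
      rw [(hker₁ z').mpr hz', hspec, Affine.Point.map_some] at h
      exact Affine.Point.some_ne_zero _ h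
    obtain ⟨n₁', hspec'⟩ := D₁.uniformize_spec z' hz'
    obtain ⟨n₀, hspec₀⟩ := D₀.uniformize_spec (ε * z) (fun hm ↦ hz ((hεmem z).mpr hm))
    obtain ⟨n₀', hspec₀'⟩ := D₀.uniformize_spec (ε * z') (fun hm ↦ hz' ((hεmem z').mpr hm))
    rw [hspec, hspec', Affine.Point.map_some, Affine.Point.some.injEq] at h
    obtain ⟨hx, hy⟩ := h
    simp only [map_sub, map_mul, map_div₀, hA₁, hA₃, hB₁, h2, h12] at hx hy
    have hPz : (σ : ℂ →ₐ[ℚ] ℂ) (D₁.L.weierstrassP z) = D₁.L.weierstrassP z' := by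
      linear_combination hx
    have hP'z : (σ : ℂ →ₐ[ℚ] ℂ) (D₁.L.derivWeierstrassP z) = D₁.L.derivWeierstrassP z' := by
      rw [hPz] at hy
      linear_combination 2 * hy
    rw [hspec₀, hspec₀', Affine.Point.map_some, Affine.Point.some.injEq]
    refine ⟨?_, ?_⟩
    · rw [hP z, hP z']
      simp only [map_sub, map_div₀, hB₀, h12, hPz]
    · rw [hP' z, hP' z', hP z, hP z']
      simp only [map_sub, map_mul, map_div₀, hA₁', hA₃', hB₀, h2, h12, hPz, hP'z, hσε]

end Transfer

/-- **THEOREM K — the index-`4` Kummer–diamond reciprocity on the `X₀(N)`-optimal curve (stub D5 of the LEAD line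
`kummer_diamond`; THEOREM modulo T-es-75 ∧ CES).**  For a globally minimal elliptic `W₀/ℚ` with a lattice-optimal
`X₀(N)`-datum `D₀` in the index-`4` configuration `Λ₁(f) = 2Λ₀(f)` (the hypotheses of E-es-185), the Kummer point
`S = π₀(c₀·{∞,1/y}_f / 2)` over the Atkin–Lehner point `R_Q = π₀(c₀·{∞,1/y}_f)` (`N = Q·y`, `gcd(Q,y) = 1`) satisfies,
for every `σ ∈ Aut_ℚ(ℂ)` with `σ(ζ_N) = ζ_N^d`, `dd′ ≡ 1 (mod N)`, and every `γ ∈ Γ₀(N)` with `d_γ ≡ d′ (mod Q)`,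
`d_γ ≡ 1 (mod y)`:  `σ(S) = S + π₀(c₀·{∞,γ∞}_f / 2)` — the `2`-descent cocycle of `S` at `σ` is the diamond image
`ϖ_Q(χ_Q(σ)⁻¹) ∈ W₀[2]` (MEMO-es §59.3 THEOREM K, §59.5 STEP 2 input).  Proof: CES gives Stevens' curve `W₁` with an
optimal `X₁(N)`-datum `D₁` and the same newform; index `4` forces `Λ_{E₀} = Λ_{E₁}` and `c₀ = ±2c₁`
(`lattice_eq_of_index_four`, `maninConstant₀_eq_mul_or_eq_neg_mul_of_periodLatticeGamma1_eq_mul`), so `S = π₀(±c₁ s)`;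
THEOREM K♮ on `W₁` (`kummerDiamondReciprocity`) and the Galois transfer `map_uniformize_transfer_of_lattice_eq` give the
claim.  [cite: Stevens1982, Thm. 1.3.1(b)] [cite: ConradEdixhovenStein2003, §6.1, Lemma 6.1.6] [cite: Stevens1989, §2] -/
theorem indexFour_kummerDiamondReciprocity (hSt : optimalGamma1Parametrization_cuspInv_galoisAction)
    (hCES : exists_optimal_gamma1ParametrizationData) (W₀ : WeierstrassCurve ℚ) [W₀.IsElliptic] [W₀.IsGloballyMinimal]
    {N : ℕ} [NeZero N] (D₀ : ModularParametrizationData W₀ N)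
    (hopt : ∀ z ∈ D₀.L.lattice, ∃ w ∈ periodLattice D₀.f, z = D₀.c * w)
    (h4 : ∀ z : ℂ, z ∈ periodLatticeGamma1 D₀.f ↔ ∃ w ∈ periodLattice D₀.f, z = 2 * w)
    (σ : ℂ ≃ₐ[ℚ] ℂ) (d d' : ℤ) (hdd' : ((d * d' : ℤ) : ZMod N) = 1)
    (hσ : σ (Complex.exp (2 * Real.pi * Complex.I / N)) = Complex.exp (2 * Real.pi * Complex.I * d / N))
    (Q y : ℕ) (hQy : Q * y = N) (hcop : Nat.Coprime Q y) (γ : Gamma0 N)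
    (hγQ : (((γ : SL(2, ℤ)) 1 1 : ℤ) : ZMod Q) = (d' : ZMod Q)) (hγy : (((γ : SL(2, ℤ)) 1 1 : ℤ) : ZMod y) = 1) :
    Affine.Point.map (W' := W₀) (σ : ℂ →ₐ[ℚ] ℂ) (D₀.uniformize ((D₀.c : ℂ) * modularSymbol D₀.f (1 / (y : ℚ)) / 2)) =
      D₀.uniformize ((D₀.c : ℂ) * modularSymbol D₀.f (1 / (y : ℚ)) / 2) +
        D₀.uniformize ((D₀.c : ℂ) * cuspSymbol D₀.f γ / 2) := by
  obtain ⟨W₁, _, _, D₁, hiso, hD₁⟩ := hCES W₀ D₀ hopt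
  have hf : D₁.f = D₀.f := D₁.f_eq_of_isIsogenous D₀ hiso
  have hidx : ∀ z : ℂ, z ∈ periodLatticeGamma1 D₁.f ↔ ∃ w ∈ periodLattice D₀.f, z = 2 * w := by
    rw [hf]; exact h4
  have hidx' : ∀ z : ℂ, z ∈ periodLatticeGamma1 D₁.f ↔ ∃ w ∈ periodLattice D₀.f, z = ((2 : ℤ) : ℂ) * w := by
    intro z; rw [hidx z, Int.cast_ofNat]
  have hΛ : D₀.L.lattice = D₁.L.lattice := lattice_eq_of_index_four D₁ D₀ hD₁ hopt hidx
  -- `c₀ = ε · 2c₁`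
  obtain ⟨ε, hε, hcc⟩ : ∃ ε : ℂ, (ε = 1 ∨ ε = -1) ∧ (D₀.c : ℂ) = ε * (2 * D₁.c) := by
    rcases maninConstant₀_eq_mul_or_eq_neg_mul_of_periodLatticeGamma1_eq_mul D₁ D₀ hD₁ hopt 2 hidx' with h | h
    · refine ⟨1, Or.inl rfl, ?_⟩
      rw [one_mul]
      exact_mod_cast h
    · refine ⟨-1, Or.inr rfl, ?_⟩
      rw [neg_one_mul]
      exact_mod_cast h
  -- THEOREM K on Stevens' curve, in the form `σ(π₁(c₁ s)) = π₁(c₁ (s + u))`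
  have hK := kummerDiamondReciprocity hSt W₁ D₁ hD₁ σ d d' hdd' hσ Q y hQy hcop γ hγQ hγy
  rw [hf, ← map_add, ← mul_add] at hK
  have hT := map_uniformize_transfer_of_lattice_eq D₁ D₀ hΛ hε σ hK
  have e1 : (D₀.c : ℂ) * modularSymbol D₀.f (1 / (y : ℚ)) / 2 = ε * ((D₁.c : ℂ) * modularSymbol D₀.f (1 / (y : ℚ))) := by
    rw [hcc]; ring
  have e2 : (D₀.c : ℂ) * cuspSymbol D₀.f γ / 2 = ε * ((D₁.c : ℂ) * cuspSymbol D₀.f γ) := by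
    rw [hcc]; ring
  rw [e1, e2, ← map_add, ← mul_add, ← mul_add]
  exact hT

end IndexFour

end Summit.BirchSwinnertonDyer.Rank1Residual.ManinAdditive.KummerDiamond

end
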